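import Summits.BirchSwinnertonDyer.BirchSwinnertonDyer.Theorems.EdixhovenFibreFiveSevenStarredOptimalManinUnitFiveSevenGoodModelFormula
import Literature.NumberTheory.PAdicHodge.CMFibreCellsGoodOrdinaryData
import Literature.NumberTheory.PAdicHodge.AinfWeierstrassRamifiedCellsOrdinary
import HarnessLib

/-!
# The good `𝒪_D`-MODEL DATA of an ORDINARY-cell curve over `K_{v′}` — the per-cell inputs of the unit-root frame, DISCHARGED
# (route `EdixhovenFibreFiveSeven`, crux K★ stmt-BirchSwinnertonDyer-22226, line `kato-lever`, stub `stub_localFormulaOrdinaryCells` of skeleton v11;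
# seat `bsd-line-edix-p4` g29, width)

HONEST FRAMING. TOOL theorems only (no definition, no named fact, no instance, no `sorry`); nothing is closed; BSD / K★ / the LOC@ord stub are NOT
proved by this. ORDINARY twin of the MODEL-DATA HALF (§1–§4) of `…GoodModelFormula.exists_goodModel_formula_of_numerology` (LEAD g30, the three potentially
supersingular cells): for a globally minimal `W/ℚ` in a (G)-ORDINARY K★ cell — `(5; III*)` (`ord₅ Δ_min = 9`), `(7; IV*)` (`ord₇ Δ_min = 8`), `(7; II*)`
(`ord₇ Δ_min = 10`) — a number field `K ∋ α` with `α^e = p` (`e = 4, 3, 6`) and a place `v′ ∋ p` of `K`, it CONSTRUCTS over `F = K_{v′}` the Eisenstein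
datum `D = (X^e − p, α)`, the bridge `ψ : 𝒪_D → 𝒪_F`, the good model `W_D = ⟨0,0,0,a ϖ^{r₄}, b ϖ^{r₆}⟩` (`(a, b) = (−27A, −54B)` from the cell numerology
of `…SupersingularCellsModels`, verbatim), the variable change `C` with `C • (W ⊗ F) = E := curveFO F (W_D ⊗_ψ 𝒪_F)`, and DISCHARGES every model-side
input of the ORDINARY road: `IsUnit Δ` (`AinfTop.isUnit_Δ_map_model`), **`A_p(W_D ⊗ 𝒪_F mod 𝔪_F) ≠ 0`** (`AinfTop.hasseCoeff_red_map_model_ne_zero_of_isUnit_cells`),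
**`[Xᵖ][p]_{W_D ⊗ 𝒪_F}` a unit of `𝒪_{ℂ_F}`** (the hypothesis `h1` of `FormalGroupDivisionHeightOne.exists_evalPt₁_formalMul_prime_eq` and of
`FormalDivisionTowersOrdinary.exists_divSeq_geomToCO_mem_kernel`), the CM fibre `E₀ ∈ {y² = x³ + a x (p = 5), y² = x³ + b (p = 7)}` with `W_D ≡ E₀ (mod ϖ)`
(`map_explicitModel_eq_map_cmFibre`), `p ∤ Δ(E₀)`, **`A_p(E₀ mod p) ≠ 0`**, **`p ∤ a_p(E₀)`, `‖a_p(E₀)‖_p = 1`** (the hypothesis of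
`FrobeniusUnitRoot.exists_unitRoot_frobeniusPoly`) and **`a_p(E₀)² < 4p`** (the hypothesis of `UnitRootPeriodWitt.unitRoot_pow_ne_one`)
(`CMFibreCellsGoodOrdinaryData`).

* ★★★ `exists_goodModelData_of_ordinary_numerology` — generic ordinary numerology `(e, k, m, n, r₄, r₆, t₄, t₆)`
  (`r₄ = t₄ = 0 < t₆` at `5`, `r₆ = t₆ = 0 < t₄` at `7`);
* ★★★ `exists_goodModelData_of_ordinaryCell` — the three cells `(5; III*) ↦ (4; 3,3,5; 0,2; 0,1)`, `(7; IV*) ↦ (3; 2,3,4; 1,0; 1,0)`,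
  `(7; II*) ↦ (6; 5,4,5; 4,0; 2,0)`, keyed exactly as the stub `stub_localFormulaOrdinaryCells` (`(p = 5 ↔ ord_p Δ_min = 9)` and its cell table).

WHAT IS LEFT for the stub after this file: the ORDINARY CAPSTONE (Kato's formula at the formal / all points of the model `E` in the unit-root frame — LEAD
bricks B3/B4 of memo `Cruxes/…/Lines/kato-lever-seam-rec-at-cells.md` §17), its transport to `W′ ⊗ F` (E3–E6 twins), and the generic socket binders.

References: [SilvermanAEC2009] VII.5.5, IV.4.4, V.1.1, V.4.1, Ex. V.4.4–4.5; [SilvermanATAEC1994] IV Table 4.1; [Serre1972] §1.11.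
-/

set_option autoImplicit false
-- single-conjunct summit: `Summit.BirchSwinnertonDyer.BirchSwinnertonDyer.…` repeats the name by design
set_option linter.dupNamespace false

noncomputable section

open Field Function ValuativeRel WittVector NumberField IsDedekindDomain Polynomial
open scoped NumberField Topology Classical NNReal
open Literature.NumberTheory.PAdicHodge Literature.NumberTheory.GaloisRepresentations
  Literature.NumberTheory.GaloisRepresentations.IsNonarchimedeanLocalField Literature.NumberTheory.GaloisRepresentations.LubinTate
  Literature.NumberTheory.GaloisCohomology Literature.NumberTheory.EllipticCurves Literature.NumberTheory.EllipticCurves.FormalGroupChart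
  Literature.NumberTheory.PAdicHodge.GaloisContinuity Literature.IUT.LogVolume Literature.RingTheory.FormalGroups
  Literature.AlgebraicGeometry.Resolution _root_.WeierstrassCurve
  Literature.NumberTheory.EllipticCurves.Rank1Residual Literature.NumberTheory.DiophantineGeometry Rat.HeightOneSpectrum
  Summit.BirchSwinnertonDyer.Rank1Residual Summit.BirchSwinnertonDyer.Rank1Residual.Additive
  Summit.BirchSwinnertonDyer.BirchSwinnertonDyer.Theorems.StarredOptimalManinUnitFiveSevenSupersingularCellsModels

namespace Summit.BirchSwinnertonDyer.BirchSwinnertonDyer.Theorems.StarredOptimalManinUnitFiveSevenOrdinaryCellsModels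

variable (W : WeierstrassCurve ℚ) [W.IsElliptic] [W.IsGloballyMinimal] (p : ℕ) [hp : Fact p.Prime]

set_option maxHeartbeats 1600000 in
/-- ★★★ **The good `𝒪_D`-model of a K★ ORDINARY-cell curve over `F = K_{v′}` with all its reduction data, generic ordinary numerology.**
For `W/ℚ` globally minimal, `p ∈ {5, 7}`, `ord_p j(W) ≥ 0`, numerology `(e, k, m, n, r₄, r₆, t₄, t₆)` (`e m = 4k + r₄`, `e n = 6k + r₆`, `3r₄ = e t₄`, `2r₆ = e t₆`,
`3m = ord_p Δ_min + t₄`, `2n = ord_p Δ_min + t₆`, `t₄ ≤ 2`, `t₆ ≤ 1`, and the ORDINARY pattern `r₄ = t₄ = 0 < t₆` at `5`, `r₆ = t₆ = 0 < t₄` at `7`), a number field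
`K ∋ α`, `α^e = p`, and a place `v′ ∋ p`: there are an Eisenstein datum `D` of `F` with `D.poly = X^e − p`, a model `W_D` over `𝒪_D` of the shape
`⟨0, 0, 0, a·ϱ^{r₄}, b·ϱ^{r₆}⟩` (`a = −27A`, `b = −54B ∈ ℤ`), a bridge `ψ : 𝒪_D → 𝒪_F` over `F` and a variable change `C` over `F` with `C • (W ⊗ F) = curveFO F (W_D ⊗_ψ 𝒪_F)`,
such that: `Δ(W_D ⊗_ψ 𝒪_F)` is a unit, `A_p(W_D ⊗_ψ 𝒪_F mod 𝔪_F) ≠ 0`, `[Xᵖ][p]_{W_D ⊗_ψ 𝒪_F}` maps to a unit of `𝒪_{ℂ_F}`, and the CM fibre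
`E₀ = ⟨0,0,0, [r₄ = 0]a, [r₆ = 0]b⟩/ℤ` has `W_D ≡ E₀ (mod ϱ)`, `p ∤ Δ(E₀)`, `A_p(E₀ mod p) ≠ 0`, `p ∤ a_p(E₀)`, `‖a_p(E₀)‖_p = 1`, `a_p(E₀)² < 4p`.
[cite: SilvermanAEC2009, VII.5.5, IV.4.4, V.1.1, V.4.1 and Ex. V.4.4–4.5] [cite: Serre1972, §1.11] -/
theorem exists_goodModelData_of_ordinary_numerology (hp57 : p = 5 ∨ p = 7) (hj : 0 ≤ padicValRat p W.j)
    {e k m n r₄ r₆ t₄ t₆ : ℕ} (he : 0 < e) (hem : e * m = 4 * k + r₄) (hen : e * n = 6 * k + r₆)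
    (h₄ : 3 * r₄ = e * t₄) (h₆ : 2 * r₆ = e * t₆)
    (hm : 3 * m = padicValInt p W.minimalDiscriminantInt + t₄) (hn : 2 * n = padicValInt p W.minimalDiscriminantInt + t₆)
    (ht₄ : t₄ ≤ 2) (ht₆ : t₆ ≤ 1) (h5 : p = 5 → r₄ = 0 ∧ t₄ = 0 ∧ 0 < t₆) (h7 : p = 7 → r₆ = 0 ∧ t₆ = 0 ∧ 0 < t₄)
    {K : Type} [Field K] [NumberField K] {α : K} (hαe : α ^ e = (p : K))
    (v' : HeightOneSpectrum (𝓞 K))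
    [CharZero (v'.adicCompletion K)]
    (hp' : valuation (v'.adicCompletion K) ((p : ℕ) : v'.adicCompletion K) < 1) :
    ∃ (D : EisensteinRoot (v'.adicCompletion K) p hp') (_ : D.poly = X ^ e - C (p : ℤ_[p])) (a b : ℤ)
      (Wm : WeierstrassCurve (EisensteinRoot.CoeffDisc D)) (ψ₀ : EisensteinRoot.CoeffDisc D →+* LTCoeff (v'.adicCompletion K))
      (Cv : VariableChange (v'.adicCompletion K)),
      (∀ c, algebraMap (LTCoeff (v'.adicCompletion K)) (v'.adicCompletion K) (ψ₀ c) = EisensteinRoot.CoeffDisc.toF D c) ∧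
      Wm = ⟨0, 0, 0, algebraMap ℤ (EisensteinRoot.CoeffDisc D) a * EisensteinRoot.CoeffDisc.of D (AdjoinRoot.root D.poly) ^ r₄,
        algebraMap ℤ (EisensteinRoot.CoeffDisc D) b * EisensteinRoot.CoeffDisc.of D (AdjoinRoot.root D.poly) ^ r₆⟩ ∧
      IsUnit (64 * (a : ℤ_[p]) ^ 3 * (p : ℤ_[p]) ^ t₄ + 432 * (b : ℤ_[p]) ^ 2 * (p : ℤ_[p]) ^ t₆) ∧
      Cv • W.baseChange (v'.adicCompletion K) = AinfTop.curveFO (v'.adicCompletion K) (Wm.map ψ₀) ∧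
      IsUnit (Wm.map ψ₀).Δ ∧
      ((Wm.map ψ₀).map (AinfTop.redCoeff (v'.adicCompletion K))).hasseCoeff p ≠ 0 ∧
      IsUnit (algebraMap (LTCoeff (v'.adicCompletion K)) (CBall (v'.adicCompletion K)) (PowerSeries.coeff p ((Wm.map ψ₀).formalMul p))) ∧
      Wm.map (Ideal.Quotient.mk (Ideal.span {EisensteinRoot.CoeffDisc.of D (AdjoinRoot.root D.poly)})) =
        ((⟨0, 0, 0, if r₄ = 0 then a else 0, if r₆ = 0 then b else 0⟩ : WeierstrassCurve ℤ).map
          (algebraMap ℤ (EisensteinRoot.CoeffDisc D))).map (Ideal.Quotient.mk (Ideal.span {EisensteinRoot.CoeffDisc.of D (AdjoinRoot.root D.poly)})) ∧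
      ¬ (p : ℤ) ∣ ((⟨0, 0, 0, if r₄ = 0 then a else 0, if r₆ = 0 then b else 0⟩ : WeierstrassCurve ℤ)).Δ ∧
      (((⟨0, 0, 0, if r₄ = 0 then a else 0, if r₆ = 0 then b else 0⟩ : WeierstrassCurve ℤ).map (Int.castRingHom (ZMod p)))).hasseCoeff p ≠ 0 ∧
      ¬ (p : ℤ) ∣ HasseManin.tr (((⟨0, 0, 0, if r₄ = 0 then a else 0, if r₆ = 0 then b else 0⟩ : WeierstrassCurve ℤ).map (Int.castRingHom (ZMod p)))) ∧
      ‖((HasseManin.tr (((⟨0, 0, 0, if r₄ = 0 then a else 0, if r₆ = 0 then b else 0⟩ : WeierstrassCurve ℤ).map (Int.castRingHom (ZMod p)))) : ℤ) :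
          ℤ_[p])‖ = 1 ∧
      HasseManin.tr (((⟨0, 0, 0, if r₄ = 0 then a else 0, if r₆ = 0 then b else 0⟩ : WeierstrassCurve ℤ).map (Int.castRingHom (ZMod p)))) ^ 2 <
        4 * p := by
  have hpr : p.Prime := hp.out
  have hp5 : 5 ≤ p := by rcases hp57 with rfl | rfl <;> norm_num
  have hp2 : p ≠ 2 := by omega
  -- the ORDINARY cell pattern in the two shapes used below
  have hr : (p = 5 → r₄ = 0) ∧ (p = 7 → r₆ = 0) := ⟨fun h => (h5 h).1, fun h => (h7 h).1⟩
  have ht : (p = 5 → t₄ = 0 ∧ 0 < t₆) ∧ (p = 7 → 0 < t₄ ∧ t₆ = 0) :=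
    ⟨fun h => ⟨(h5 h).2.1, (h5 h).2.2⟩, fun h => ⟨(h7 h).2.2, (h7 h).2.1⟩⟩
  have hrr : (p = 5 → r₄ = 0 ∧ 0 < r₆) ∧ (p = 7 → 0 < r₄ ∧ r₆ = 0) := by
    refine ⟨fun h => ⟨(h5 h).1, ?_⟩, fun h => ⟨?_, (h7 h).1⟩⟩
    · obtain ⟨-, -, ht₆⟩ := h5 h
      rcases Nat.eq_zero_or_pos r₆ with h0 | h0
      · exfalso; rw [h0, mul_zero] at h₆; have := Nat.mul_pos he ht₆; omega
      · exact h0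
    · obtain ⟨-, -, ht₄⟩ := h7 h
      rcases Nat.eq_zero_or_pos r₄ with h0 | h0
      · exfalso; rw [h0, mul_zero] at h₄; have := Nat.mul_pos he ht₄; omega
      · exact h0
  -- §1 the cell numerology (verbatim from `…GoodModelFormula.exists_goodModel_formula_of_numerology`)
  set V := integralModelInt W with hV
  set vΔ := padicValInt p W.minimalDiscriminantInt with hvΔ
  obtain ⟨A, hA⟩ := pow_dvd_c₄_of_padicValRat_j_nonneg W p hj (m := m) (by omega)
  obtain ⟨B, hB⟩ := pow_dvd_c₆_of_padicValRat_j_nonneg W p hj (n := n) (by omega)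
  have hΔ0 : V.Δ ≠ 0 := minimalDiscriminantInt_ne_zero W
  obtain ⟨dd, hd⟩ : (p : ℤ) ^ vΔ ∣ V.Δ := (padicValInt_dvd_iff _ _).2 (Or.inr le_rfl)
  have hpd : ¬ (p : ℤ) ∣ dd := by
    rintro ⟨d', rfl⟩
    have : (p : ℤ) ^ (vΔ + 1) ∣ V.Δ := ⟨d', by rw [hd, pow_succ]; ring⟩
    rcases (padicValInt_dvd_iff _ _).1 this with h | h
    · exact hΔ0 h
    · have h' : vΔ + 1 ≤ vΔ := h
      omega
  have hid := unit_identity (q := (p : ℤ)) (by exact_mod_cast hpr.ne_zero) hA.symm hB.symm hd.symm V.c_relation hm hn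
  have hz : ¬ (p : ℤ) ∣ -(6 ^ 12 * dd) := by
    rw [dvd_neg]
    intro h
    rcases (Nat.prime_iff_prime_int.mp hpr).dvd_or_dvd h with h6 | h6
    · have hp6 : (p : ℤ) ∣ 6 := Int.Prime.dvd_pow' hpr h6
      rcases hp57 with rfl | rfl <;> norm_num at hp6
    · exact hpd h6
  have hU : ¬ (p : ℤ) ∣ 64 * (-27 * A) ^ 3 * (p : ℤ) ^ t₄ + 432 * (-54 * B) ^ 2 * (p : ℤ) ^ t₆ := by rwa [hid]
  have hunit : IsUnit (64 * (-27 * (A : ℤ_[p])) ^ 3 * (p : ℤ_[p]) ^ t₄ + 432 * (-54 * (B : ℤ_[p])) ^ 2 * (p : ℤ_[p]) ^ t₆) := by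
    have hu : IsUnit (((-(6 ^ 12 * dd) : ℤ)) : ℤ_[p]) := by
      rw [PadicInt.isUnit_iff]
      exact le_antisymm (PadicInt.norm_le_one _) (not_lt.1 fun h => hz ((PadicInt.norm_int_lt_one_iff_dvd _).1 h))
    rw [← hid] at hu
    push_cast at hu
    exact hu
  have hunit' : IsUnit (64 * (((-27 * A : ℤ) : ℤ_[p])) ^ 3 * (p : ℤ_[p]) ^ t₄ + 432 * (((-54 * B : ℤ) : ℤ_[p])) ^ 2 * (p : ℤ_[p]) ^ t₆) := by
    push_cast
    exact hunit
  have hα0 : α ≠ 0 := by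
    intro h0; rw [h0, zero_pow he.ne'] at hαe; exact (Nat.cast_ne_zero.2 hpr.ne_zero) hαe.symm
  -- §2 the `K`-model `S ≅ W ×_ℚ K`
  set S : WeierstrassCurve K := ⟨0, 0, 0, -27 * (V.c₄ : K) / (α ^ k) ^ 4, -54 * (V.c₆ : K) / (α ^ k) ^ 6⟩ with hS
  have hWK : W.baseChange K = V.map (Int.castRingHom K) := by
    rw [WeierstrassCurve.baseChange, ← map_integralModelInt W, WeierstrassCurve.map_map]
    congr 1
    exact RingHom.ext_int _ _
  have hc4K : (W.baseChange K).c₄ = (V.c₄ : K) := by rw [hWK, WeierstrassCurve.map_c₄, eq_intCast]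
  have hc6K : (W.baseChange K).c₆ = (V.c₆ : K) := by rw [hWK, WeierstrassCurve.map_c₆, eq_intCast]
  have h6 : (6 : K) ≠ 0 := by norm_num
  obtain ⟨C, hC⟩ := exists_variableChange_eq_short (L := K) two_ne_zero three_ne_zero (W.baseChange K)
    (u := α ^ k / 6) (div_ne_zero (pow_ne_zero _ hα0) h6)
  have e4 : -(V.c₄ : K) / (48 * (α ^ k / 6) ^ 4) = -27 * (V.c₄ : K) / (α ^ k) ^ 4 := by
    have : (α ^ k) ≠ 0 := pow_ne_zero _ hα0
    field_simp
    ring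
  have e6 : -(V.c₆ : K) / (864 * (α ^ k / 6) ^ 6) = -54 * (V.c₆ : K) / (α ^ k) ^ 6 := by
    have : (α ^ k) ≠ 0 := pow_ne_zero _ hα0
    field_simp
    ring
  have hC' : C • W.baseChange K = S := by rw [hC, hS, hc4K, hc6K, e4, e6]
  -- §3 over `F = K_{v′}`: `ϖ = α`, `D = (X^e − p, ϖ)`, `ψ : 𝒪_D → 𝒪_F`, the good model `W_D`
  obtain ⟨ϖ, hϖ⟩ : ∃ ϖ : v'.adicCompletion K, ϖ = algebraMap K (v'.adicCompletion K) α := ⟨_, rfl⟩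
  have hϖe : ϖ ^ e = (p : v'.adicCompletion K) := by rw [hϖ, ← map_pow, hαe, map_natCast]
  have hϖ0 : ϖ ≠ 0 := by rw [hϖ]; exact (_root_.map_ne_zero _).2 hα0
  obtain ⟨D, hD, hDroot⟩ := EisensteinRoot.exists_poly_eq_X_pow_sub_C hp' he hϖe
  have hroot := D.root_pow_eq_of_poly_eq hD
  obtain ⟨ψ₀, hψ₀⟩ : ∃ ψ₀ : EisensteinRoot.CoeffDisc D →+* LTCoeff (v'.adicCompletion K),
      ∀ c, algebraMap (LTCoeff (v'.adicCompletion K)) (v'.adicCompletion K) (ψ₀ c) = EisensteinRoot.CoeffDisc.toF D c := by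
    obtain ⟨β, hβ⟩ := EisensteinRoot.exists_coeffToLTCoeff D
    exact ⟨β.comp (EisensteinRoot.CoeffDisc.of D).symm.toRingHom, fun c => hβ _⟩
  haveI : CharP 𝓀[v'.adicCompletion K] p := charP_residueField_of_valuation_lt_one hp'
  -- the model over `𝒪_D` (both presentations) and its reduction data
  set WD : WeierstrassCurve D.Coeff := ⟨0, 0, 0, AdjoinRoot.of D.poly ((-27 * A : ℤ) : ℤ_[p]) * AdjoinRoot.root D.poly ^ r₄,
      AdjoinRoot.of D.poly ((-54 * B : ℤ) : ℤ_[p]) * AdjoinRoot.root D.poly ^ r₆⟩ with hWD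
  set Wm : WeierstrassCurve (EisensteinRoot.CoeffDisc D) := WD.map (EisensteinRoot.CoeffDisc.of D).toRingHom with hWm
  have hWmψ : Wm.map ψ₀ = WD.map (ψ₀.comp (EisensteinRoot.CoeffDisc.of D).toRingHom) := by rw [hWm, WeierstrassCurve.map_map]
  have hΔ : IsUnit (Wm.map ψ₀).Δ := by
    rw [hWmψ]; exact AinfTop.isUnit_Δ_map_model (F := v'.adicCompletion K) hD (ψ₀.comp (EisensteinRoot.CoeffDisc.of D).toRingHom) _ _ h₄ h₆ hunit'
  have hHasse : ((Wm.map ψ₀).map (AinfTop.redCoeff (v'.adicCompletion K))).hasseCoeff p ≠ 0 := by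
    rw [hWmψ]
    exact AinfTop.hasseCoeff_red_map_model_ne_zero_of_isUnit_cells hD (ψ₀.comp (EisensteinRoot.CoeffDisc.of D).toRingHom) _ _ hp57 hr ht hunit'
  have h1 : IsUnit (algebraMap (LTCoeff (v'.adicCompletion K)) (CBall (v'.adicCompletion K))
      (PowerSeries.coeff p ((Wm.map ψ₀).formalMul p))) :=
    AinfTop.isUnit_algebraMap_coeff_prime_formalMul_of_hasseCoeff_red_ne_zero _ hp2 hHasse
  -- `E := (W_D ⊗_ψ 𝒪_F) ⊗ F = W_D ⊗_{𝒪_D} F = S ⊗ F = (C ⊗ F) • (W ⊗ F)`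
  have hEWD : AinfTop.curveFO (v'.adicCompletion K) (Wm.map ψ₀) = WD.map (EisensteinRoot.Coeff.toF D) := by
    rw [hWm]; exact AinfRamTop.curveFO_map_of_map_ψ WD ψ₀ hψ₀
  have hSF : S.baseChange (v'.adicCompletion K) = WD.map (EisensteinRoot.Coeff.toF D) := by
    rw [hWD, map_model_toF, hDroot]
    have hp4 : (ϖ ^ k) ^ 4 * ϖ ^ r₄ = (p : v'.adicCompletion K) ^ m := by
      rw [← pow_mul, ← pow_add, show k * 4 + r₄ = e * m by omega, pow_mul, hϖe]
    have hp6 : (ϖ ^ k) ^ 6 * ϖ ^ r₆ = (p : v'.adicCompletion K) ^ n := by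
      rw [← pow_mul, ← pow_add, show k * 6 + r₆ = e * n by omega, pow_mul, hϖe]
    have hc4F : ((V.c₄ : ℤ) : v'.adicCompletion K) = (ϖ ^ k) ^ 4 * ϖ ^ r₄ * (A : v'.adicCompletion K) := by
      rw [hp4, hA]; push_cast; ring
    have hc6F : ((V.c₆ : ℤ) : v'.adicCompletion K) = (ϖ ^ k) ^ 6 * ϖ ^ r₆ * (B : v'.adicCompletion K) := by
      rw [hp6, hB]; push_cast; ring
    have hϖk : ϖ ^ k ≠ 0 := pow_ne_zero _ hϖ0
    have ha4 : algebraMap K (v'.adicCompletion K) (-27 * (V.c₄ : K) / (α ^ k) ^ 4) =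
        zpToF hp' ((-27 * A : ℤ) : ℤ_[p]) * ϖ ^ r₄ := by
      rw [map_div₀, map_mul, map_neg, map_ofNat, map_intCast, map_pow, map_pow, ← hϖ, map_intCast, hc4F]
      field_simp
      push_cast
      ring
    have ha6 : algebraMap K (v'.adicCompletion K) (-54 * (V.c₆ : K) / (α ^ k) ^ 6) =
        zpToF hp' ((-54 * B : ℤ) : ℤ_[p]) * ϖ ^ r₆ := by
      rw [map_div₀, map_mul, map_neg, map_ofNat, map_intCast, map_pow, map_pow, ← hϖ, map_intCast, hc6F]
      field_simp
      push_cast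
      ring
    exact WeierstrassCurve.ext (map_zero _) (map_zero _) (map_zero _) ha4 ha6
  have hWKF : (W.baseChange K).baseChange (v'.adicCompletion K) = W.baseChange (v'.adicCompletion K) :=
    (W.map_baseChange (IsScalarTower.toAlgHom ℚ K (v'.adicCompletion K)))
  have hCE : (C.map (algebraMap K (v'.adicCompletion K))) • W.baseChange (v'.adicCompletion K) =
      AinfTop.curveFO (v'.adicCompletion K) (Wm.map ψ₀) := by
    rw [hEWD, ← hSF, ← hC', ← hWKF]
    simp only [WeierstrassCurve.baseChange, WeierstrassCurve.map_variableChange]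
  -- §4 the CM fibre `E₀` and its ORDINARY data
  set a : ℤ := -27 * A with ha
  set b : ℤ := -54 * B with hb
  have hWmE : Wm = ⟨0, 0, 0, algebraMap ℤ (EisensteinRoot.CoeffDisc D) a * EisensteinRoot.CoeffDisc.of D (AdjoinRoot.root D.poly) ^ r₄,
      algebraMap ℤ (EisensteinRoot.CoeffDisc D) b * EisensteinRoot.CoeffDisc.of D (AdjoinRoot.root D.poly) ^ r₆⟩ := by
    rw [hWm, hWD]
    refine WeierstrassCurve.ext (map_zero _) (map_zero _) (map_zero _) ?_ ?_ <;>
    · simp only [WeierstrassCurve.map, RingEquiv.toRingHom_eq_coe, RingHom.coe_coe, map_mul, map_pow, map_intCast, eq_intCast]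
  have hWE : Wm.map (Ideal.Quotient.mk (Ideal.span {EisensteinRoot.CoeffDisc.of D (AdjoinRoot.root D.poly)})) =
      (((⟨0, 0, 0, if r₄ = 0 then a else 0, if r₆ = 0 then b else 0⟩ : WeierstrassCurve ℤ)).map (algebraMap ℤ (EisensteinRoot.CoeffDisc D))).map
        (Ideal.Quotient.mk (Ideal.span {EisensteinRoot.CoeffDisc.of D (AdjoinRoot.root D.poly)})) := by
    rw [hWmE]; exact map_explicitModel_eq_map_cmFibre D a b r₄ r₆
  have hunitab : IsUnit (64 * (a : ℤ_[p]) ^ 3 * (p : ℤ_[p]) ^ t₄ + 432 * (b : ℤ_[p]) ^ 2 * (p : ℤ_[p]) ^ t₆) := by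
    rw [ha, hb]; exact hunit'
  obtain ⟨ha5, hb7⟩ := not_dvd_of_isUnit_cells_ord a b hp57 ht hunitab
  refine ⟨D, hD, a, b, Wm, ψ₀, C.map (algebraMap K (v'.adicCompletion K)), hψ₀, hWmE, hunitab, hCE, hΔ, hHasse, h1, hWE,
    not_dvd_Δ_cmFibre_ord a b r₄ r₆ hp57 hrr ha5 hb7, hasseCoeff_cmFibre_ne_zero a b r₄ r₆ hp57 hr.1 hr.2 ha5 hb7,
    not_dvd_tr_cmFibre a b r₄ r₆ hp57 hrr ha5 hb7, norm_intCast_tr_cmFibre_eq_one a b r₄ r₆ hp57 hrr ha5 hb7,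
    tr_cmFibre_sq_lt_four_mul a b r₄ r₆ hp57 hrr ha5 hb7⟩

/-- ★★★ **The good `𝒪_D`-model data on the three (G)-ORDINARY K★ cells**, keyed as the stub `stub_localFormulaOrdinaryCells` of skeleton v11: for a globally
minimal `W/ℚ`, `p ∈ {5, 7}`, additive reduction at `p`, no `Iₙ*` fibre at `p`, `4 < ord_p Δ_min`, `(p = 5 ↔ ord_p Δ_min = 9)` (the cells `(5; III*)`, `(7; IV*)`,
`(7; II*)`), a number field `K ∋ α` with `α^e = p`, `e` from the cell table (`9 ↦ 4`, `8 ↦ 3`, `10 ↦ 6`), and a place `v′ ∋ p`: the conclusion of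
`exists_goodModelData_of_ordinary_numerology` at the numerology `(4; 3,3,5; 0,2; 0,1)`, `(3; 2,3,4; 1,0; 1,0)`, `(6; 5,4,5; 4,0; 2,0)`.
[cite: SilvermanATAEC1994, IV Table 4.1] [cite: SilvermanAEC2009, VII.5.5, V.4.1 and Ex. V.4.4–4.5] -/
theorem exists_goodModelData_of_ordinaryCell (hp57 : p = 5 ∨ p = 7) (hadd : Addv W p)
    (hIstar : ∀ (v : HeightOneSpectrum ℤ) (n : ℕ), natGenerator v = p → W.kodairaSymbolAt v ≠ KodairaSymbol.Istar n)
    (h4 : 4 < padicValInt p W.minimalDiscriminantInt) {e : ℕ}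
    (htab : p = 5 ∧ padicValInt p W.minimalDiscriminantInt = 9 ∧ e = 4 ∨ p = 7 ∧ padicValInt p W.minimalDiscriminantInt = 8 ∧ e = 3 ∨
      p = 7 ∧ padicValInt p W.minimalDiscriminantInt = 10 ∧ e = 6)
    {K : Type} [Field K] [NumberField K] {α : K} (hαe : α ^ e = (p : K))
    (v' : HeightOneSpectrum (𝓞 K)) [CharZero (v'.adicCompletion K)]
    (hp' : valuation (v'.adicCompletion K) ((p : ℕ) : v'.adicCompletion K) < 1) :
    ∃ (r₄ r₆ t₄ t₆ : ℕ) (D : EisensteinRoot (v'.adicCompletion K) p hp') (_ : D.poly = X ^ e - C (p : ℤ_[p])) (a b : ℤ)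
      (Wm : WeierstrassCurve (EisensteinRoot.CoeffDisc D)) (ψ₀ : EisensteinRoot.CoeffDisc D →+* LTCoeff (v'.adicCompletion K))
      (Cv : VariableChange (v'.adicCompletion K)),
      ((p = 5 → r₄ = 0 ∧ t₄ = 0 ∧ 0 < t₆) ∧ (p = 7 → r₆ = 0 ∧ t₆ = 0 ∧ 0 < t₄)) ∧
      (∀ c, algebraMap (LTCoeff (v'.adicCompletion K)) (v'.adicCompletion K) (ψ₀ c) = EisensteinRoot.CoeffDisc.toF D c) ∧
      Wm = ⟨0, 0, 0, algebraMap ℤ (EisensteinRoot.CoeffDisc D) a * EisensteinRoot.CoeffDisc.of D (AdjoinRoot.root D.poly) ^ r₄,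
        algebraMap ℤ (EisensteinRoot.CoeffDisc D) b * EisensteinRoot.CoeffDisc.of D (AdjoinRoot.root D.poly) ^ r₆⟩ ∧
      IsUnit (64 * (a : ℤ_[p]) ^ 3 * (p : ℤ_[p]) ^ t₄ + 432 * (b : ℤ_[p]) ^ 2 * (p : ℤ_[p]) ^ t₆) ∧
      Cv • W.baseChange (v'.adicCompletion K) = AinfTop.curveFO (v'.adicCompletion K) (Wm.map ψ₀) ∧
      IsUnit (Wm.map ψ₀).Δ ∧
      ((Wm.map ψ₀).map (AinfTop.redCoeff (v'.adicCompletion K))).hasseCoeff p ≠ 0 ∧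
      IsUnit (algebraMap (LTCoeff (v'.adicCompletion K)) (CBall (v'.adicCompletion K)) (PowerSeries.coeff p ((Wm.map ψ₀).formalMul p))) ∧
      Wm.map (Ideal.Quotient.mk (Ideal.span {EisensteinRoot.CoeffDisc.of D (AdjoinRoot.root D.poly)})) =
        ((⟨0, 0, 0, if r₄ = 0 then a else 0, if r₆ = 0 then b else 0⟩ : WeierstrassCurve ℤ).map
          (algebraMap ℤ (EisensteinRoot.CoeffDisc D))).map (Ideal.Quotient.mk (Ideal.span {EisensteinRoot.CoeffDisc.of D (AdjoinRoot.root D.poly)})) ∧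
      ¬ (p : ℤ) ∣ ((⟨0, 0, 0, if r₄ = 0 then a else 0, if r₆ = 0 then b else 0⟩ : WeierstrassCurve ℤ)).Δ ∧
      (((⟨0, 0, 0, if r₄ = 0 then a else 0, if r₆ = 0 then b else 0⟩ : WeierstrassCurve ℤ).map (Int.castRingHom (ZMod p)))).hasseCoeff p ≠ 0 ∧
      ¬ (p : ℤ) ∣ HasseManin.tr (((⟨0, 0, 0, if r₄ = 0 then a else 0, if r₆ = 0 then b else 0⟩ : WeierstrassCurve ℤ).map (Int.castRingHom (ZMod p)))) ∧
      ‖((HasseManin.tr (((⟨0, 0, 0, if r₄ = 0 then a else 0, if r₆ = 0 then b else 0⟩ : WeierstrassCurve ℤ).map (Int.castRingHom (ZMod p)))) : ℤ) :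
          ℤ_[p])‖ = 1 ∧
      HasseManin.tr (((⟨0, 0, 0, if r₄ = 0 then a else 0, if r₆ = 0 then b else 0⟩ : WeierstrassCurve ℤ).map (Int.castRingHom (ZMod p)))) ^ 2 <
        4 * p := by
  have hp5 : 5 ≤ p := by rcases hp57 with rfl | rfl <;> norm_num
  have hgen : natGenerator (placeOf p) = p := congrArg Subtype.val ((primesEquiv (R := ℤ)).apply_symm_apply ⟨p, hp.out⟩)
  obtain ⟨hj, -⟩ := padicValRat_j_nonneg_and_mem_of_starred W p hp5 hadd (fun n => hIstar (placeOf p) n hgen) h4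
  rcases htab with ⟨rfl, h9, rfl⟩ | ⟨rfl, h8, rfl⟩ | ⟨rfl, h10, rfl⟩
  · obtain ⟨D, hD, a, b, Wm, ψ₀, Cv, h⟩ := exists_goodModelData_of_ordinary_numerology W 5 (Or.inl rfl) hj (e := 4) (k := 3) (m := 3) (n := 5)
      (r₄ := 0) (r₆ := 2) (t₄ := 0) (t₆ := 1) (by norm_num) (by norm_num) (by norm_num) (by norm_num) (by norm_num) (by rw [h9]) (by rw [h9])
      (by norm_num) (by norm_num) (fun _ => ⟨rfl, rfl, by norm_num⟩) (fun h => by norm_num at h) hαe v' hp'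
    exact ⟨0, 2, 0, 1, D, hD, a, b, Wm, ψ₀, Cv, ⟨fun _ => ⟨rfl, rfl, by norm_num⟩, fun h => by norm_num at h⟩, h⟩
  · obtain ⟨D, hD, a, b, Wm, ψ₀, Cv, h⟩ := exists_goodModelData_of_ordinary_numerology W 7 (Or.inr rfl) hj (e := 3) (k := 2) (m := 3) (n := 4)
      (r₄ := 1) (r₆ := 0) (t₄ := 1) (t₆ := 0) (by norm_num) (by norm_num) (by norm_num) (by norm_num) (by norm_num) (by rw [h8]) (by rw [h8])
      (by norm_num) (by norm_num) (fun h => by norm_num at h) (fun _ => ⟨rfl, rfl, by norm_num⟩) hαe v' hp'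
    exact ⟨1, 0, 1, 0, D, hD, a, b, Wm, ψ₀, Cv, ⟨fun h => by norm_num at h, fun _ => ⟨rfl, rfl, by norm_num⟩⟩, h⟩
  · obtain ⟨D, hD, a, b, Wm, ψ₀, Cv, h⟩ := exists_goodModelData_of_ordinary_numerology W 7 (Or.inr rfl) hj (e := 6) (k := 5) (m := 4) (n := 5)
      (r₄ := 4) (r₆ := 0) (t₄ := 2) (t₆ := 0) (by norm_num) (by norm_num) (by norm_num) (by norm_num) (by norm_num) (by rw [h10]) (by rw [h10])
      (by norm_num) (by norm_num) (fun h => by norm_num at h) (fun _ => ⟨rfl, rfl, by norm_num⟩) hαe v' hp'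
    exact ⟨4, 0, 2, 0, D, hD, a, b, Wm, ψ₀, Cv, ⟨fun h => by norm_num at h, fun _ => ⟨rfl, rfl, by norm_num⟩⟩, h⟩


/-! ## `|u| ≤ 1` for ANY change of variables onto the good model (the hypothesis `hu` of E6 `…TransportedReciprocityOfVariableChange`) -/

omit hp in
/-- **`ω(u) ≤ 1` for a change of variables from an `ω`-integral-discriminant equation onto a unit-discriminant one**: if `C • X = Y`, `ω(Δ_X) ≤ 1` and
`ω(Δ_Y) = 1` then `ω(u_C) ≤ 1` (`Δ_Y = u⁻¹² Δ_X`, AEC III.1 Table 3.1). [cite: SilvermanAEC2009, III.1 (Table 3.1) and VII.1] -/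
theorem valuation_u_le_one_of_smul_eq {L : Type*} [Field L] (ω : Valuation L ℝ≥0) {X Y : WeierstrassCurve L} {C : VariableChange L}
    (h : C • X = Y) (hX : ω X.Δ ≤ 1) (hY : ω Y.Δ = 1) : ω (C.u : L) ≤ 1 := by
  have hΔ : Y.Δ = (C.u : L)⁻¹ ^ 12 * X.Δ := by rw [← h, variableChange_Δ, Units.val_inv_eq_inv_val]
  have hu0 : ω (C.u : L) ≠ 0 := (Valuation.ne_zero_iff _).mpr C.u.ne_zero
  rw [hΔ, map_mul, map_pow, map_inv₀] at hY
  -- `ω(u)¹² = ω(Δ_X) ≤ 1`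
  have h12 : ω (C.u : L) ^ 12 = ω X.Δ := by
    have h' := congrArg (fun t => ω (C.u : L) ^ 12 * t) hY
    simp only [mul_one] at h'
    rw [← h', ← mul_assoc, ← mul_pow, mul_inv_cancel₀ hu0, one_pow, one_mul]
  exact (pow_le_one_iff_of_nonneg bot_le (by norm_num)).1 (h12 ▸ hX)

omit hp [W.IsElliptic] in
/-- ★ **`ω′(u_C) ≤ 1` for EVERY change of variables `C` over `K_{v′}` with `C • (W ⊗ K_{v′}) = curveFO (X)`, `X/𝒪_F` of unit discriminant, `W/ℚ` globally minimal**
(any compatible `ω′`): the hypothesis `hu` of `…TransportedReciprocityOfVariableChange` / `…LocalFormulaSupersingularCellsNumerology` §6 for the variable change `Cv` of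
`exists_goodModelData_of_ordinary_numerology` / `_of_ordinaryCell` (whose `u = α^k/6` is not exported; none is needed: `|u|¹² = |Δ_min(W)|_{v′} ≤ 1`).
[cite: SilvermanAEC2009, III.1 (Table 3.1), VII.1 and VIII.8] -/
theorem valuation_u_le_one_of_smul_eq_curveFO {K : Type} [Field K] [NumberField K] (v' : HeightOneSpectrum (𝓞 K))
    (ω' : Valuation (v'.adicCompletion K) ℝ≥0) [ω'.Compatible] (X : WeierstrassCurve (LTCoeff (v'.adicCompletion K))) (hX : IsUnit X.Δ)
    {C : VariableChange (v'.adicCompletion K)} (h : C • W.baseChange (v'.adicCompletion K) = AinfTop.curveFO (v'.adicCompletion K) X) :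
    ω' (C.u : v'.adicCompletion K) ≤ 1 := by
  have hwv : ω'.IsEquiv (valuation (v'.adicCompletion K)) := ValuativeRel.isEquiv ω' (valuation (v'.adicCompletion K))
  have hint : ∀ a : LTCoeff (v'.adicCompletion K), ω' (algebraMap (LTCoeff (v'.adicCompletion K)) (v'.adicCompletion K) a) ≤ 1 := fun a =>
    hwv.le_one_iff_le_one.mpr ((Valuation.mem_integer_iff _ _).mp ((LTCoeff.of (v'.adicCompletion K)).symm a).2)
  -- `ω′(Δ(curveFO X)) = 1`: the image of a unit of `𝒪_F`
  have hY : ω' (AinfTop.curveFO (v'.adicCompletion K) X).Δ = 1 := by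
    obtain ⟨u, hu⟩ := hX
    rw [WeierstrassCurve.map_Δ, ← hu]
    refine le_antisymm (hint _) ?_
    have h1 : ω' (algebraMap (LTCoeff (v'.adicCompletion K)) (v'.adicCompletion K) (u : LTCoeff (v'.adicCompletion K))) *
        ω' (algebraMap (LTCoeff (v'.adicCompletion K)) (v'.adicCompletion K) (↑u⁻¹ : LTCoeff (v'.adicCompletion K))) = 1 := by
      rw [← map_mul, ← map_mul, Units.mul_inv, map_one, map_one]
    by_contra hlt
    rw [not_le] at hlt
    have : ω' (algebraMap (LTCoeff (v'.adicCompletion K)) (v'.adicCompletion K) (u : LTCoeff (v'.adicCompletion K))) *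
        ω' (algebraMap (LTCoeff (v'.adicCompletion K)) (v'.adicCompletion K) (↑u⁻¹ : LTCoeff (v'.adicCompletion K))) < 1 :=
      mul_lt_one_of_nonneg_of_lt_one_left bot_le hlt (hint _)
    exact absurd h1 this.ne
  -- `ω′(Δ(W ⊗ K_{v′})) ≤ 1`: an integer
  have hXΔ : ω' (W.baseChange (v'.adicCompletion K)).Δ ≤ 1 := by
    have e1 : (W.baseChange (v'.adicCompletion K)).Δ = ((W.minimalDiscriminantInt : ℚ) : v'.adicCompletion K) := by
      rw [WeierstrassCurve.baseChange, WeierstrassCurve.map_Δ, W.cast_minimalDiscriminantInt, eq_ratCast]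
    rw [e1, Rat.cast_intCast]
    exact Literature.NumberTheory.EllipticCurves.val_intCast_le_one ω' _
  exact valuation_u_le_one_of_smul_eq ω' h hXΔ hY

end Summit.BirchSwinnertonDyer.BirchSwinnertonDyer.Theorems.StarredOptimalManinUnitFiveSevenOrdinaryCellsModels

end
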